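import Summits.MatrixMultiplication.MatrixMultiplication.Theorems.PrimeTwoFamilies.Negative.Slices
import Summits.MatrixMultiplication.MatrixMultiplication.Theorems.PrimeTwoFamilies.Negative.Shapes
import Summits.MatrixMultiplication.MatrixMultiplication.Theorems.PrimeLogDecay.Negative.LoadBearing

/-!
# `PrimeTwoFamilies` (crux stmt-MatrixMultiplication-14308): the translate baseline — every slice
# `δ > 1/2` holds with ONE shape (tightness of `Shapes.not_rightShapedPrimeTwoFamiliesAt`)

Negative-side support file of the crux disprover (cdisprove seat); everything `sorry`-free.

* `translate_design` — at level `n ≥ 1`, block size `s ≥ 1`: a Bertrand prime `p ∈ (2ns², 4ns²]` for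
  which `Aᵢ = i·s² + [0,s)`, `Bᵢ = i·s² + s·[0,s)` form an SDPP family in `ℤ/p` with ONE right shape and
  `|Aᵢ| = |Bᵢ| = s` (`trA`, `trB`, `tr_W`, `tr_X`, via the `blk` API of the PrimeLogDecay seat).
* `singleton_WX`, `blockSize_bounds`, `exists_level` — shared bookkeeping.
* `rightShapedPrimeTwoFamiliesAt_one` (`1/2 < δ ⇒ RightShapedPrimeTwoFamiliesAt 1 δ`),
  `RightShapedPrimeTwoFamiliesAt.primeTwoFamiliesAt`, `primeTwoFamiliesAt_of_gt_half` — the threshold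
  `1/2` of `Shapes` is exact and every slice `δ > 1/2` of the crux HOLDS: its open range is `δ ∈ (0, 1/2]`.
-/

namespace Summit.MatrixMultiplication.MatrixMultiplication.Theorems.PrimeTwoFamilies.Negative

open Finset
open Summit.MatrixMultiplication.MatrixMultiplication.Theses
open Literature.Computability.AlgebraicComplexity

/-- The strengthening implies the slice. -/
theorem RightShapedPrimeTwoFamiliesAt.primeTwoFamiliesAt {K : ℕ} {δ : ℝ}
    (h : RightShapedPrimeTwoFamiliesAt K δ) : PrimeTwoFamiliesAt δ := by
  intro n₀
  obtain ⟨n, hn, p, hp, A, B, -, hW, hX, hpn, hAB⟩ := h n₀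
  exact ⟨n, hn, p, hp, A, B, hW, hX, hpn, hAB⟩

/-! ## §5 Tightness of §2: translates realise every slice `δ > 1/2` with ONE shape -/

section Translates
open scoped Pointwise
open Summit.MatrixMultiplication.MatrixMultiplication.Theorems.PrimeLogDecay.Negative
  (blk mem_blk blk_card blk_W blk_X natCast_inj_of_lt)

/-- Translate design, `A`-side: `A_i = i·s² + [0, s)` (as a `Fin s`-parametrised block). -/
def trA (p n s : ℕ) : Fin n → Fin s → ZMod p := fun i t => (((i : ℕ) * s ^ 2 + t : ℕ) : ZMod p)

/-- Translate design, `B`-side: `B_i = i·s² + s·[0, s)`. -/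
def trB (p n s : ℕ) : Fin n → Fin s → ZMod p := fun i u => (((i : ℕ) * s ^ 2 + s * u : ℕ) : ZMod p)

/-- No wrap-around: all the sums compared by (W)/(X) stay below `2ns²`. -/
theorem tr_sum_lt {n s : ℕ} (i j : Fin n) (t u : Fin s) :
    (i : ℕ) * s ^ 2 + t + ((j : ℕ) * s ^ 2 + s * u) < 2 * n * s ^ 2 := by
  have hi : (i : ℕ) + 1 ≤ n := i.isLt
  have hj : (j : ℕ) + 1 ≤ n := j.isLt
  have ht : (t : ℕ) + 1 ≤ s := t.isLt
  have hu : (u : ℕ) + 1 ≤ s := u.isLt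
  have h1 : ((i : ℕ) + 1) * s ^ 2 ≤ n * s ^ 2 := Nat.mul_le_mul_right _ hi
  have h2 : ((j : ℕ) + 1) * s ^ 2 ≤ n * s ^ 2 := Nat.mul_le_mul_right _ hj
  have h3 : s * ((u : ℕ) + 1) ≤ s * s := Nat.mul_le_mul_left _ hu
  nlinarith [h1, h2, h3, ht]

/-- A block value splits as `s²·(index) + (offset < s²)`. -/
theorem tr_offset_lt {s : ℕ} (t u : Fin s) : (t : ℕ) + s * u < s ^ 2 := by
  have ht : (t : ℕ) + 1 ≤ s := t.isLt
  have hu : (u : ℕ) + 1 ≤ s := u.isLt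
  have h3 : s * ((u : ℕ) + 1) ≤ s * s := Nat.mul_le_mul_left _ hu
  nlinarith [h3, ht]

/-- (X) for the translate design once `p > 2ns²`: compare the `s²`-quotients. -/
theorem tr_X {p n s : ℕ} (hs : 0 < s) (hp : 2 * n * s ^ 2 < p) :
    ∀ i j k : Fin n, ∀ t t' u u' : Fin s,
      trA p n s i t - trA p n s j t' + (trB p n s j u - trB p n s k u') = 0 → i = k := by
  intro i j k t t' u u' h
  simp only [trA, trB] at h
  have h1 : ((((i : ℕ) * s ^ 2 + t + ((j : ℕ) * s ^ 2 + s * u)) : ℕ) : ZMod p) =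
      ((((j : ℕ) * s ^ 2 + t' + ((k : ℕ) * s ^ 2 + s * u')) : ℕ) : ZMod p) := by
    push_cast at h ⊢
    linear_combination h
  rw [natCast_inj_of_lt ((tr_sum_lt i j t u).trans hp) ((tr_sum_lt j k t' u').trans hp)] at h1
  have hs2 : 0 < s ^ 2 := by positivity
  have e1 : (i : ℕ) * s ^ 2 + t + ((j : ℕ) * s ^ 2 + s * u) = s ^ 2 * (i + j) + (t + s * u) := by ring
  have e2 : (j : ℕ) * s ^ 2 + t' + ((k : ℕ) * s ^ 2 + s * u') = s ^ 2 * (j + k) + (t' + s * u') := by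
    ring
  rw [e1, e2] at h1
  have h2 := congrArg (· / s ^ 2) h1
  simp only [Nat.mul_add_div hs2, Nat.div_eq_of_lt (tr_offset_lt t u),
    Nat.div_eq_of_lt (tr_offset_lt t' u'), add_zero] at h2
  exact Fin.ext (by omega)

/-- (W) for the translate design once `p > 2ns²`: offsets `t + s·u` determine `(t, u)`. -/
theorem tr_W {p n s : ℕ} (hs : 0 < s) (hp : 2 * n * s ^ 2 < p) :
    ∀ i : Fin n, ∀ t t' u u' : Fin s,
      trA p n s i t - trA p n s i t' + (trB p n s i u - trB p n s i u') = 0 → t = t' ∧ u = u' := by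
  intro i t t' u u' h
  simp only [trA, trB] at h
  have h1 : ((((i : ℕ) * s ^ 2 + t + ((i : ℕ) * s ^ 2 + s * u)) : ℕ) : ZMod p) =
      ((((i : ℕ) * s ^ 2 + t' + ((i : ℕ) * s ^ 2 + s * u')) : ℕ) : ZMod p) := by
    push_cast at h ⊢
    linear_combination h
  rw [natCast_inj_of_lt ((tr_sum_lt i i t u).trans hp) ((tr_sum_lt i i t' u').trans hp)] at h1
  have h2 : (t : ℕ) + s * u = t' + s * u' := by omega
  have hmod := congrArg (· % s) h2
  simp only [Nat.add_mul_mod_self_left, Nat.mod_eq_of_lt t.isLt, Nat.mod_eq_of_lt t'.isLt] at hmod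
  refine ⟨Fin.ext hmod, Fin.ext ?_⟩
  rw [hmod] at h2
  exact Nat.eq_of_mul_eq_mul_left hs (by omega)

/-- `trA p n s i` is injective once `p > 2ns²`. -/
theorem trA_inj {p n s : ℕ} (hp : 2 * n * s ^ 2 < p) :
    ∀ i : Fin n, ∀ t t' : Fin s, trA p n s i t = trA p n s i t' → t = t' := by
  intro i t t' h
  have hs : 0 < s := by have := t.isLt; omega
  let u0 : Fin s := ⟨0, hs⟩
  have hb : ∀ t : Fin s, (i : ℕ) * s ^ 2 + t < p := fun t => by
    have := tr_sum_lt i i t u0; omega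
  simp only [trA] at h
  exact Fin.ext (by have := (natCast_inj_of_lt (hb t) (hb t')).1 h; omega)

/-- `trB p n s i` is injective once `p > 2ns²`. -/
theorem trB_inj {p n s : ℕ} (hp : 2 * n * s ^ 2 < p) :
    ∀ i : Fin n, ∀ u u' : Fin s, trB p n s i u = trB p n s i u' → u = u' := by
  intro i u u' h
  have hs : 0 < s := by have := u.isLt; omega
  let t0 : Fin s := ⟨0, hs⟩
  have hb : ∀ u : Fin s, (i : ℕ) * s ^ 2 + s * u < p := fun u => by
    have := tr_sum_lt i i t0 u; omega
  simp only [trB] at h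
  have h1 := (natCast_inj_of_lt (hb u) (hb u')).1 h
  exact Fin.ext (Nat.eq_of_mul_eq_mul_left hs (by omega))

/-- The `B`-blocks of the translate design are translates of ONE template. -/
theorem blk_trB_eq_vadd {p n s : ℕ} (i : Fin n) :
    blk (trB p n s) i = (((i : ℕ) * s ^ 2 : ℕ) : ZMod p) +ᵥ
      (Finset.univ.image fun u : Fin s => ((s * u : ℕ) : ZMod p)) := by
  rw [Finset.vadd_finset_def, Finset.image_image]
  unfold blk
  congr 1
  funext u
  simp only [Function.comp, vadd_eq_add, trB]
  push_cast
  ring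

/-- **The translate design, packaged**: at level `n ≥ 1` with block size `s ≥ 1` there is a
Bertrand prime `p ∈ (2ns², 4ns²]` for which the translates `Aᵢ = i·s² + [0,s)`, `Bᵢ = i·s² + s·[0,s)`
form an SDPP family in `ℤ/p` with ONE right shape and `|Aᵢ| = |Bᵢ| = s`. -/
theorem translate_design (n s : ℕ) (hn : 1 ≤ n) (hs : 0 < s) :
    ∃ p : ℕ, p.Prime ∧ 2 * n * s ^ 2 < p ∧ p ≤ 4 * n * s ^ 2 ∧
      UsesRightShapes (blk (trB p n s)) 1 ∧ IsSDPP (blk (trA p n s)) (blk (trB p n s)) ∧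
      ∀ i : Fin n, (blk (trA p n s) i).card = s ∧ (blk (trB p n s) i).card = s := by
  obtain ⟨p, hp, hMp, hp2M⟩ := Nat.exists_prime_lt_and_le_two_mul (2 * n * s ^ 2) (by positivity)
  refine ⟨p, hp, hMp, by linarith, ?_, ⟨blk_W _ _ (tr_W hs hMp), blk_X _ _ (tr_X hs hMp)⟩,
    blk_card _ _ (trA_inj hMp) (trB_inj hMp)⟩
  exact ⟨fun _ => Finset.univ.image fun u : Fin s => ((s * u : ℕ) : ZMod p), fun _ => 0,
    fun i => (((i : ℕ) * s ^ 2 : ℕ) : ZMod p), fun i => blk_trB_eq_vadd i⟩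

/-- **Singleton design** `Aᵢ = Bᵢ = {i}` (`i < n ≤ p`) in `ℤ/p`: clauses (W) and (X). -/
theorem singleton_WX (p n : ℕ) (hnp : n ≤ p) :
    (∀ i : Fin n, ∀ a ∈ ({((i : ℕ) : ZMod p)} : Finset (ZMod p)),
      ∀ a' ∈ ({((i : ℕ) : ZMod p)} : Finset (ZMod p)), ∀ b ∈ ({((i : ℕ) : ZMod p)} : Finset (ZMod p)),
      ∀ b' ∈ ({((i : ℕ) : ZMod p)} : Finset (ZMod p)), (a - a') + (b - b') = 0 → a = a' ∧ b = b') ∧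
    (∀ i j k : Fin n, ∀ a ∈ ({((i : ℕ) : ZMod p)} : Finset (ZMod p)),
      ∀ a' ∈ ({((j : ℕ) : ZMod p)} : Finset (ZMod p)), ∀ b ∈ ({((j : ℕ) : ZMod p)} : Finset (ZMod p)),
      ∀ b' ∈ ({((k : ℕ) : ZMod p)} : Finset (ZMod p)), (a - a') + (b - b') = 0 → i = k) := by
  refine ⟨fun i a ha a' ha' b hb b' hb' _ => ?_, fun i j k a ha a' ha' b hb b' hb' h0 => ?_⟩
  · rw [mem_singleton] at ha ha' hb hb'
    exact ⟨ha.trans ha'.symm, hb.trans hb'.symm⟩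
  · rw [mem_singleton] at ha ha' hb hb'
    subst ha ha' hb hb'
    have h1 : ((i : ℕ) : ZMod p) = ((k : ℕ) : ZMod p) := by
      have : ((i : ℕ) : ZMod p) - ((k : ℕ) : ZMod p) = 0 := by
        rw [← h0]; abel
      exact sub_eq_zero.1 this
    rw [ZMod.natCast_eq_natCast_iff'] at h1
    rw [Nat.mod_eq_of_lt (i.isLt.trans_le hnp), Nat.mod_eq_of_lt (k.isLt.trans_le hnp)] at h1
    exact Fin.ext h1

/-- The block size `s = ⌈n^{1-δ/2}⌉` for `δ < 2`, `n ≥ 1`: `n^{1-δ/2} ≤ s ≤ 2n^{1-δ/2}`, `s ≥ 1`,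
and `s² ≥ n^{2-δ}`, `s² ≤ 4n^{2-δ}`. -/
theorem blockSize_bounds {δ : ℝ} (hδ2 : δ < 2) {n : ℕ} (hn : 1 ≤ n) :
    0 < ⌈(n : ℝ) ^ (1 - δ / 2)⌉₊ ∧
    (n : ℝ) ^ (2 - δ) ≤ ((⌈(n : ℝ) ^ (1 - δ / 2)⌉₊ * ⌈(n : ℝ) ^ (1 - δ / 2)⌉₊ : ℕ) : ℝ) ∧
    ((⌈(n : ℝ) ^ (1 - δ / 2)⌉₊ : ℕ) : ℝ) ^ 2 ≤ 4 * (n : ℝ) ^ (2 - δ) := by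
  have hnpos : (0 : ℝ) < n := by exact_mod_cast hn
  have hn1 : (1 : ℝ) ≤ n := by exact_mod_cast hn
  have he0 : 0 ≤ 1 - δ / 2 := by linarith
  set s : ℕ := ⌈(n : ℝ) ^ (1 - δ / 2)⌉₊ with hs_def
  have hne1 : (1 : ℝ) ≤ (n : ℝ) ^ (1 - δ / 2) := Real.one_le_rpow hn1 he0
  have hs1 : (n : ℝ) ^ (1 - δ / 2) ≤ s := Nat.le_ceil _
  have hs2 : (s : ℝ) < (n : ℝ) ^ (1 - δ / 2) + 1 := Nat.ceil_lt_add_one (by positivity)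
  have hs3 : (s : ℝ) ≤ 2 * (n : ℝ) ^ (1 - δ / 2) := by linarith
  have hspos : 0 < s := by
    have : (0 : ℝ) < s := lt_of_lt_of_le (by linarith) hs1
    exact_mod_cast this
  have h4 : (n : ℝ) ^ (2 - δ) = (n : ℝ) ^ (1 - δ / 2) * (n : ℝ) ^ (1 - δ / 2) := by
    rw [← Real.rpow_add hnpos]; congr 1; ring
  refine ⟨hspos, ?_, ?_⟩
  · push_cast
    rw [h4]
    exact mul_le_mul hs1 hs1 (by positivity) (Nat.cast_nonneg _)
  · have h3 : (s : ℝ) ^ 2 ≤ (2 * (n : ℝ) ^ (1 - δ / 2)) ^ 2 :=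
      pow_le_pow_left₀ (Nat.cast_nonneg _) hs3 2
    nlinarith [h3, h4]

/-- A level `n ≥ max(n₀, 1)` with `C < n^κ` (for `κ > 0`). -/
theorem exists_level (n₀ : ℕ) (C κ : ℝ) (hC : 0 ≤ C) (hκ : 0 < κ) :
    ∃ n : ℕ, n₀ ≤ n ∧ 1 ≤ n ∧ C < (n : ℝ) ^ κ := by
  refine ⟨n₀ + ⌈C ^ (1 / κ)⌉₊ + 1, by omega, by omega, ?_⟩
  have h1 := Nat.le_ceil (C ^ (1 / κ))
  have h2 : (⌈C ^ (1 / κ)⌉₊ : ℝ) < ((n₀ + ⌈C ^ (1 / κ)⌉₊ + 1 : ℕ) : ℝ) := by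
    push_cast; linarith
  have h3 : C ^ (1 / κ) < ((n₀ + ⌈C ^ (1 / κ)⌉₊ + 1 : ℕ) : ℝ) := by linarith
  have h4 := Real.rpow_lt_rpow (Real.rpow_nonneg hC _) h3 hκ
  rwa [← Real.rpow_mul hC, one_div_mul_cancel hκ.ne', Real.rpow_one] at h4

/-- **Tightness of §2 (and the translate baseline of the crux)**: for every `δ > 1/2` the slice is
realised by designs with ONE right shape — for `δ < 2` the translates `A_i = i·s² + [0,s)`,
`B_i = i·s² + s·[0,s)`, `s = ⌈n^{1-δ/2}⌉`, in `ℤ/p` for a Bertrand prime `p ∈ (2ns², 4ns²]`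
(`p ≤ 16 n^{3-δ} ≤ n^{2+δ}` as soon as `n^{2δ-1} ≥ 16`); for `δ ≥ 2` singletons.  So the
threshold `1/2` in `not_rightShapedPrimeTwoFamiliesAt` is exact, and `PrimeTwoFamiliesAt δ` holds
for every `δ > 1/2` — the open range of the crux is `δ ∈ (0, 1/2]` (designs) versus `δ → 0`. -/
theorem rightShapedPrimeTwoFamiliesAt_one {δ : ℝ} (hδ : 1 / 2 < δ) :
    RightShapedPrimeTwoFamiliesAt 1 δ := by
  intro n₀
  by_cases hδ2 : 2 ≤ δ
  · -- singletons
    obtain ⟨p, hn₀p, hp⟩ := Nat.exists_infinite_primes (n₀ + 2)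
    haveI : Fact p.Prime := ⟨hp⟩
    refine ⟨p, by omega, p, hp, fun i => {((i : ℕ) : ZMod p)}, fun i => {((i : ℕ) : ZMod p)},
      ?_, (singleton_WX p p le_rfl).1, (singleton_WX p p le_rfl).2, ?_, ?_⟩
    · refine ⟨fun _ => {0}, fun _ => 0, fun i => ((i : ℕ) : ZMod p), fun i => ?_⟩
      rw [Finset.vadd_finset_singleton, vadd_eq_add, add_zero]
    · have hp1 : (1 : ℝ) ≤ p := by exact_mod_cast hp.one_lt.le
      calc (p : ℝ) = (p : ℝ) ^ (1 : ℝ) := (Real.rpow_one _).symm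
        _ ≤ (p : ℝ) ^ (2 + δ) := Real.rpow_le_rpow_of_exponent_le hp1 (by linarith)
    · intro i
      simp only [card_singleton, mul_one, Nat.cast_one]
      have hp1 : (1 : ℝ) ≤ p := by exact_mod_cast hp.one_lt.le
      exact Real.rpow_le_one_of_one_le_of_nonpos hp1 (by linarith)
  · push Not at hδ2
    -- the level `n`: beyond `n₀` and with `n^{2δ-1} > 16`
    obtain ⟨n, hn₀n, hn1nat, h16⟩ := exists_level n₀ 16 (2 * δ - 1) (by norm_num) (by linarith)
    have hnpos : (0 : ℝ) < n := by exact_mod_cast hn1nat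
    -- the block size and the design
    obtain ⟨hspos, hsize, hs2⟩ := blockSize_bounds hδ2 hn1nat
    obtain ⟨p, hp, -, hp4, hshape, hS, hcard⟩ := translate_design n _ hn1nat hspos
    refine ⟨n, hn₀n, p, hp, _, _, hshape, hS.1, hS.2, ?_, fun i => ?_⟩
    · -- host size: `p ≤ 4ns² ≤ 16 n^{3-δ} ≤ n^{2+δ}`
      have h1 : (p : ℝ) ≤ 4 * (n : ℝ) * ((⌈(n : ℝ) ^ (1 - δ / 2)⌉₊ : ℕ) : ℝ) ^ 2 := by
        exact_mod_cast hp4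
      have h6 : (n : ℝ) * (n : ℝ) ^ (2 - δ) = (n : ℝ) ^ (3 - δ) := by
        rw [show (3 - δ : ℝ) = 1 + (2 - δ) by ring, Real.rpow_add hnpos, Real.rpow_one]
      have h5 : 4 * (n : ℝ) * ((⌈(n : ℝ) ^ (1 - δ / 2)⌉₊ : ℕ) : ℝ) ^ 2 ≤ 16 * (n : ℝ) ^ (3 - δ) := by
        nlinarith [mul_le_mul_of_nonneg_left hs2 hnpos.le]
      have h7 : 16 * (n : ℝ) ^ (3 - δ) ≤ (n : ℝ) ^ (2 + δ) := by
        have h8 : (n : ℝ) ^ (2 + δ) = (n : ℝ) ^ (2 * δ - 1) * (n : ℝ) ^ (3 - δ) := by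
          rw [← Real.rpow_add hnpos]; congr 1; ring
        rw [h8]
        exact mul_le_mul_of_nonneg_right h16.le (Real.rpow_nonneg hnpos.le _)
      linarith
    · -- sizes: `|A_i||B_i| = s² ≥ n^{2-δ}`
      rw [(hcard i).1, (hcard i).2]
      exact hsize

/-- Hence every slice `δ > 1/2` of the crux HOLDS (translate baseline). -/
theorem primeTwoFamiliesAt_of_gt_half {δ : ℝ} (hδ : 1 / 2 < δ) : PrimeTwoFamiliesAt δ :=
  (rightShapedPrimeTwoFamiliesAt_one hδ).primeTwoFamiliesAt

end Translates

end Summit.MatrixMultiplication.MatrixMultiplication.Theorems.PrimeTwoFamilies.Negative
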